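import Summits.HubbardSuperconductivity.HubbardSuperconductivity.Theorems.WeakCouplingBCSKlLindhardEnclosureRecords

/-!
# KL-MARGIN-SCAN reader idea-4 (lens «cascade»), round 11 «kernel-lindhard-enclosure» — CORE part 3/4: §3a floor terms · §3b ceiling terms (crude, chord, majorised hyperbola, tip rule) · §3c the certificate tree and its fused kernel evaluation

Part 3/4 of `r11/Core.lean` (sha16 2ed93ab82e33da2d; crux idea on `stmt-HubbardSuperconductivity-0158`; author hubbard-klscan-idea-4 g11; graded by
hubbard-klscan-crit-1 g3): the 1 110-line Core is split into four modules because the gate caps a Theorems file with proofs at 400 lines; content VERBATIM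
(packaging: gate-hubbard-kl-p1 g24).  Enclosures/confirmations hold MODULO the typed, unproved `FloorSoundAt`/`CeilSoundAt`; floats are floats; nothing
here asserts a KL margin at any `t′ ≠ 0`, `K₃`, `U₀`, the window or B1g dominance; a Kohn–Luttinger instability statement is not ODLRO and nothing in this
file proves superconductivity in the Hubbard model.
-/

noncomputable section

set_option linter.dupNamespace false

namespace Summit.HubbardSuperconductivity.HubbardSuperconductivity.Theorems.KlLindhardEnclosure

open Real Set MeasureTheory Literature.MathematicalPhysics.QuantumLattice
open Summit.HubbardSuperconductivity.HubbardSuperconductivity.Theorems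
open Summit.HubbardSuperconductivity.HubbardSuperconductivity.Theorems.FSPoly (cosTaylorQ cosLoQ cosUpQ piLoQ cosLoQ_le_cos
  cos_le_cosUpQ cast_cosTaylorQ)
open Summit.HubbardSuperconductivity.HubbardSuperconductivity.Theorems.KlStair (bandQ bandR piUpQ cast_bandQ
  squareDispersion_eq_bandR pi_lt_piUpQ)

/-! ## §3a FLOOR terms (round 10, verbatim up to the parametrised grid unit) -/

/-- Upper enclosure (over `D`) of `g = |ε_{p+q} − ε_p|` at a CORNER, kind `k` (`k = true`: `p` occupied, `g = ε_{p+q} − ε_p`). [folklore] -/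
def Params.gCornerUp (P : Params) (k : Bool) (x y : Pt) : ℤ :=
  if k then P.bandUpZ x.lo' y.lo' - P.bandDnZ x.hi y.hi else P.bandUpZ x.lo y.lo - P.bandDnZ x.hi' y.hi'

/-- Lower enclosure (over `D`) of `g` at a corner, kind `k`. [folklore] -/
def Params.gCornerLo (P : Params) (k : Bool) (x y : Pt) : ℤ :=
  if k then P.bandDnZ x.hi' y.hi' - P.bandUpZ x.lo y.lo else P.bandDnZ x.hi y.hi - P.bandUpZ x.lo' y.lo'

/-- Interpolation slack `E ≥ 4D·(2/3)(1 + 2|t′|)·(dz/U)²` (cell-averaged bilinear interpolation error of `g` times `4D`). [folklore] -/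
def Params.interpE (P : Params) (dz : ℤ) : ℤ := cdivZ (8 * D * (P.tpD + 2 * |P.tpN|) * dz ^ 2) (3 * P.tpD * P.U ^ 2)

/-- Is the cell inside `[−piLoZ, piLoZ)² ⊆ [−π, π)²` (only such cells may carry a FLOOR term)? [folklore] -/
def Params.inBZ (P : Params) (x0 x1 y0 y1 : Pt) : Bool :=
  decide (-P.piLoZ ≤ x0.z) && decide (x1.z ≤ P.piLoZ) && decide (-P.piLoZ ≤ y0.z) && decide (y1.z ≤ P.piLoZ)

/-- JENSEN FLOOR term (units `2^-30`) of a certified two-shell SQUARE cell of kind `k`: `⌊2^32 D dz²/(U²(SUM4 + E))⌋ ≤ 2^30 ∫_cell 1/g`. [folklore] -/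
def Params.floorInside (P : Params) (k : Bool) (x0 x1 y0 y1 : Pt) : ℤ :=
  let dz := x1.z - x0.z
  let sum4 := P.gCornerUp k x0 y0 + P.gCornerUp k x1 y0 + P.gCornerUp k x0 y1 + P.gCornerUp k x1 y1
  let den := sum4 + P.interpE dz
  if decide (0 < den) && decide (y1.z - y0.z = dz) && decide (0 < dz) then fdivZ (2 ^ 32 * D * dz ^ 2) (P.U ^ 2 * den) else 0

/-- One `a`-piece of the round-10 boundary FLOOR (inner data, log minorant, everything rounded DOWN). [folklore] -/
def Params.bdryPieceLo (P : Params) (occ : Bool) (Vhi α0 α1 bIn0 bIn1 : ℤ) : ℤ :=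
  let S1 := max (P.sUpZ α0) (P.sUpZ α1)
  let βmax := P.bStarUpZ α0
  let βmin := P.bStarDnZ α1
  if occ then
    let b0 := max βmax bIn0
    if b0 < bIn1 then
      let Z := fdivZ (S1 * (bIn1 - b0) * D) (Vhi * D + S1 * (b0 - βmin))
      fdivZ ((α1 - α0) * logLoZ Z) S1
    else 0
  else
    let b1 := min βmin bIn1
    if bIn0 < b1 then
      let Z := fdivZ (S1 * (b1 - bIn0) * D) (Vhi * D + S1 * (βmax - b1))
      fdivZ ((α1 - α0) * logLoZ Z) S1
    else 0

/-- BOUNDARY FLOOR term (round 10; units `2^-30`) of a single-straddle cell: `sh` = the straddling point is `p + q`, `occ` = the straddler is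
OCCUPIED on the crescent (far point certified EMPTY); `σx, σy` = CHECKED upper |sin| hints (units `10⁻⁴`) of the straddler's coordinates. [folklore] -/
def Params.floorBdry (P : Params) (c : Cell) (sh occ : Bool) (σx σy : ℕ) (x0 x1 y0 y1 : Pt) : ℤ :=
  let Vhi : ℤ := if sh then P.distHiZ c.e1Lo c.e1Hi else P.distHiZ c.e2Lo c.e2Hi
  let u0 := if sh then x0.z + P.q1z else x0.z
  let u1 := if sh then x1.z + P.q1z else x1.z
  let v0 := if sh then y0.z + P.q2z else y0.z
  let v1 := if sh then y1.z + P.q2z else y1.z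
  let aIn := if sh then P.cosInnerZ u0 u1 x0.lo' x0.hi' x1.lo' x1.hi' else P.cosInnerZ u0 u1 x0.lo x0.hi x1.lo x1.hi
  let bIn := if sh then P.cosInnerZ v0 v1 y0.lo' y0.hi' y1.lo' y1.hi' else P.cosInnerZ v0 v1 y0.lo y0.hi y1.lo y1.hi
  let hOK := (if sh then sinHiOK c.aLo' c.aUp' σx && sinHiOK c.bLo' c.bUp' σy else sinHiOK c.aLo c.aUp σx && sinHiOK c.bLo c.bUp σy)
    && decide (0 < σx * σy)
  match aIn, bIn with
  | some (aIn0, aIn1), some (bIn0, bIn1) =>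
    if hOK && decide (0 < Vhi) && decide (aIn0 < aIn1) && decide (bIn0 < bIn1) && P.sPos aIn0 && P.sPos aIn1 &&
        decide (-D ≤ aIn0) && decide (aIn1 ≤ D) then
      let total := ((List.range MA).map fun m =>
        P.bdryPieceLo occ Vhi (linGridZ aIn0 aIn1 MA m) (linGridZ aIn0 aIn1 MA (m + 1)) bIn0 bIn1).sum
      fdivZ (2 ^ 30 * 10 ^ 8 * total) ((σx : ℤ) * (σy : ℤ) * D)
    else 0
  | _, _ => 0

/-! ## §3b CEILING terms (new): crude, chord, majorised hyperbola, tip rule -/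

/-- CRUDE ceiling (units `2^-30`) of any cell with `L = distLo(p) + distLo(p+q) > 0`: `⌈2^30 · area · D/L⌉ ≥ 2^30 ∫_cell F`
(`F ≤ 1/(|ε_p−μ| + |ε_{p+q}−μ|) ≤ D/L`). `none` if `L = 0`. [folklore] -/
def Params.ceilCrude (P : Params) (c : Cell) (x0 x1 y0 y1 : Pt) : Option ℤ :=
  let L := P.distLoZ c.e1Lo c.e1Hi + P.distLoZ c.e2Lo c.e2Hi
  if 0 < L then some (cdivZ (2 ^ 30 * (x1.z - x0.z) * (y1.z - y0.z) * D) (P.U ^ 2 * L)) else none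

/-- CHORD ceiling (units `2^-30`) of a certified two-shell SQUARE cell of kind `k`: with `Glo ≤ D inf g`, `Ghi ≥ D sup g` and
`M ≤ 4D·avg g` (`M = max(4Glo, Σ corner lower values − E)`), `1/x ≤ chord` on `[glo, ghi]` gives
`2^30 ∫_cell 1/g ≤ ⌈2^28 D dz² (4Glo + 4Ghi − M)/(U² Glo Ghi)⌉`. [folklore] -/
def Params.ceilChord (P : Params) (c : Cell) (k : Bool) (x0 x1 y0 y1 : Pt) : Option ℤ :=
  let dz := x1.z - x0.z
  let Glo := if k then c.e2Lo - c.e1Hi else c.e1Lo - c.e2Hi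
  let Ghi := if k then c.e2Hi - c.e1Lo else c.e1Hi - c.e2Lo
  let m4 := P.gCornerLo k x0 y0 + P.gCornerLo k x1 y0 + P.gCornerLo k x0 y1 + P.gCornerLo k x1 y1 - P.interpE dz
  let M := max (4 * Glo) m4
  if decide (0 < Glo) && decide (Glo ≤ Ghi) && decide (y1.z - y0.z = dz) && decide (0 < dz) then
    some (cdivZ (2 ^ 28 * D * dz ^ 2 * (4 * Glo + 4 * Ghi - M)) (P.U ^ 2 * Glo * Ghi))
  else none

/-- One `a`-piece `[α0, α1]` of the MAJORISED hyperbola rule (numerators over `D` in and out): crescent `b`-extent `Lm` on the piece from the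
monotone `b⋆` (clamped to the outer `b`-width), slope at its piece minimum `Smin` (rounded down), far shell `Vlo`:
`(α1 − α0) · logUp(Smin·Lm/Vlo)/Smin ≥ D · ∫_{piece} da · max_b-crescent-integral`. [folklore] -/
def Params.bdryPieceUp (P : Params) (occ : Bool) (Vlo α0 α1 βLo βUp : ℤ) : ℤ :=
  let Smin := min (P.sDnZ α0) (P.sDnZ α1)
  let ext := if occ then βUp - min (P.bStarDnZ α0) (P.bStarDnZ α1) else max (P.bStarUpZ α0) (P.bStarUpZ α1) - βLo
  let Lm := max 0 (min ext (βUp - βLo))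
  if 0 < Smin then cdivZ ((α1 - α0) * logUpZ (cdivZ (Smin * Lm) Vlo)) Smin else 0

/-- Is the slope positive on the whole piece range (needed for the piece formula)? [folklore] -/
def Params.piecesOK (P : Params) (αLo αUp : ℤ) : Bool :=
  decide (0 < P.sDnZ αLo) && decide (0 < P.sDnZ αUp) && decide (αLo ≤ αUp) && decide (-D ≤ αLo) && decide (αUp ≤ D)

/-- MAJORISED HYPERBOLA ceiling (units `2^-30`) of a single-straddle cell (`sh`: straddler is `p+q`; `occ`: straddler occupied on the crescent,
i.e. far point certified EMPTY) with CHECKED lower |sin| hints `τx, τy` (units `10⁻⁴`) for the straddler's two coordinates. Three variants —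
2-D substitution `(1/(τxτy)) Σ_pieces`, `b`-substitution only `(h_x/τy)·logUp(S L_b/V)/S`, `a`-substitution only (the band is symmetric,
`a⋆ = b⋆` as functions) — each valid when its hints are positive; returns the minimum of the valid ones (or `none`). [folklore] -/
def Params.ceilBdry (P : Params) (c : Cell) (sh occ : Bool) (τx τy : ℕ) (x0 x1 y0 y1 : Pt) : Option ℤ :=
  let Vlo : ℤ := if sh then P.distLoZ c.e1Lo c.e1Hi else P.distLoZ c.e2Lo c.e2Hi
  let αLo := if sh then c.aLo' else c.aLo
  let αUp := if sh then c.aUp' else c.aUp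
  let βLo := if sh then c.bLo' else c.bLo
  let βUp := if sh then c.bUp' else c.bUp
  let okx := (if sh then sinLoOK c.aLo' c.aUp' τx else sinLoOK c.aLo c.aUp τx) && decide (0 < τx)
  let oky := (if sh then sinLoOK c.bLo' c.bUp' τy else sinLoOK c.bLo c.bUp τy) && decide (0 < τy)
  let dzx := x1.z - x0.z
  let dzy := y1.z - y0.z
  if decide (0 < Vlo) && P.piecesOK αLo αUp && P.piecesOK βLo βUp && decide (0 < dzx) && decide (0 < dzy) then
    -- variant B: substitute b only (outer integral over x of real width dzx/U)
    let SminA := min (P.sDnZ αLo) (P.sDnZ αUp)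
    let extB := if occ then βUp - min (P.bStarDnZ αLo) (P.bStarDnZ αUp) else max (P.bStarUpZ αLo) (P.bStarUpZ αUp) - βLo
    let LB := max 0 (min extB (βUp - βLo))
    let vB : Option ℤ := if oky then
      some (cdivZ (2 ^ 30 * dzx * 10 ^ 4 * logUpZ (cdivZ (SminA * LB) Vlo)) (P.U * (τy : ℤ) * SminA)) else none
    -- variant A: substitute a only (roles of the two cosines swapped; `a⋆(b)` is the same function `bStar`)
    let SminB := min (P.sDnZ βLo) (P.sDnZ βUp)
    let extA := if occ then αUp - min (P.bStarDnZ βLo) (P.bStarDnZ βUp) else max (P.bStarUpZ βLo) (P.bStarUpZ βUp) - αLo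
    let LA := max 0 (min extA (αUp - αLo))
    let vA : Option ℤ := if okx then
      some (cdivZ (2 ^ 30 * dzy * 10 ^ 4 * logUpZ (cdivZ (SminB * LA) Vlo)) (P.U * (τx : ℤ) * SminB)) else none
    -- variant AB: 2-D substitution, MA pieces in a
    let vAB : Option ℤ := if okx && oky then
      let total := ((List.range MA).map fun m =>
        P.bdryPieceUp occ Vlo (linGridZ αLo αUp MA m) (linGridZ αLo αUp MA (m + 1)) βLo βUp).sum
      some (cdivZ (2 ^ 30 * 10 ^ 8 * total) ((τx : ℤ) * (τy : ℤ) * D)) else none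
    match vA, vB, vAB with
    | none, none, none => none
    | _, _, _ =>
      let pick (o : Option ℤ) (d : ℤ) : ℤ := match o with | some v => min v d | none => d
      let big : ℤ := 2 ^ 200
      some (pick vAB (pick vB (pick vA big)))
  else none

/-- A signed interval (numerators in units `10⁻⁴/D`) — used for the partial derivatives in the tip rule. [folklore] -/
structure IV where
  /-- lower end -/
  lo : ℤ
  /-- upper end -/
  hi : ℤ

/-- Interval product. [folklore] -/
def IV.mul (a b : IV) : IV :=
  ⟨min (min (a.lo * b.lo) (a.lo * b.hi)) (min (a.hi * b.lo) (a.hi * b.hi)),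
   max (max (a.lo * b.lo) (a.lo * b.hi)) (max (a.hi * b.lo) (a.hi * b.hi))⟩

/-- Interval difference. [folklore] -/
def IV.sub (a b : IV) : IV := ⟨a.lo - b.hi, a.hi - b.lo⟩

/-- Distance of an interval from `0` (`0` if it contains `0`). [folklore] -/
def IV.absLo (a : IV) : ℤ := if 0 < a.lo then a.lo else if a.hi < 0 then -a.hi else 0

/-- The signed range (units `10⁻⁴/D`) of a partial derivative `2 sin r · (1 + 2t′ cos s)` from: the direction flag of `cos r` on the `r`-interval
(`true` = decreasing = `sin ≥ 0`), checked |sin r| hints `τ ≤ |sin r| ≤ σ` (units `10⁻⁴`), and the outer cosine range `[cLo, cHi]` of `s`. [folklore] -/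
def Params.derivIV (P : Params) (dir : Bool) (τ σ : ℕ) (cLo cHi : ℤ) : IV :=
  let opLo := min (P.opDnZ cLo) (P.opDnZ cHi)
  let opHi := max (P.opUpZ cLo) (P.opUpZ cHi)
  let mlo := 2 * (τ : ℤ) * opLo
  let mhi := 2 * (σ : ℤ) * opHi
  if dir then ⟨mlo, mhi⟩ else ⟨-mhi, -mlo⟩

/-- One orientation of the TIP RULE (units `2^-30`): monotone function with `|∂| ≥ v > 0` (units `10⁻⁴/D`), the other function's partial in the
same direction `≤ m`, `Uv ≥ D·sup|monotone function|`, outer width `dz` grid units, `Z1/D ≥ 4U₁L/(J₀h)`: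
`⌈2^31 (v + m) 10⁴ dz (logUp Z1 + D)/(v² U)⌉`. [folklore] -/
def Params.tipVariant (P : Params) (v m dz B : ℤ) : Option ℤ :=
  if 0 < v ∧ 0 ≤ m ∧ 0 < dz then some (cdivZ (2 ^ 31 * (v + m) * 10 ^ 4 * dz * B) (v ^ 2 * P.U)) else none

/-- TIP RULE ceiling (units `2^-30`) of a cell where both points may straddle, from eight CHECKED |sin| hints (lower `τ`, upper `σ`, units `10⁻⁴`)
for `p₀, p₁, p₀+q₁, p₁+q₂`. Requires certified monotonicity of all four cosines (signs of the sines), an interval determinant bounded away from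
`0` (`J₀ > 0`), and at least one orientation with a positive monotone partial; returns the minimum over the valid orientations. [folklore] -/
def Params.ceilTip (P : Params) (c : Cell) (τx σx τy σy τx' σx' τy' σy' : ℕ) (x0 x1 y0 y1 : Pt) : Option ℤ :=
  let hints := sinLoOK c.aLo c.aUp τx && sinHiOK c.aLo c.aUp σx && sinLoOK c.bLo c.bUp τy && sinHiOK c.bLo c.bUp σy &&
    sinLoOK c.aLo' c.aUp' τx' && sinHiOK c.aLo' c.aUp' σx' && sinLoOK c.bLo' c.bUp' τy' && sinHiOK c.bLo' c.bUp' σy'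
  match P.cosDirZ x0.z x1.z, P.cosDirZ y0.z y1.z, P.cosDirZ (x0.z + P.q1z) (x1.z + P.q1z), P.cosDirZ (y0.z + P.q2z) (y1.z + P.q2z) with
  | some dx, some dy, some dx', some dy' =>
    if hints && c.guards then
      -- partials: ∂ₓe₁ = 2 sin p₀ (1+2t′cos p₁), ∂_y e₁ = 2 sin p₁ (1+2t′cos p₀), ∂ₓe₂, ∂_y e₂ at the shifted point
      let X1 := P.derivIV dx τx σx c.bLo c.bUp
      let Y1 := P.derivIV dy τy σy c.aLo c.aUp
      let X2 := P.derivIV dx' τx' σx' c.bLo' c.bUp'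
      let Y2 := P.derivIV dy' τy' σy' c.aLo' c.aUp'
      let J0 := ((X1.mul Y2).sub (Y1.mul X2)).absLo      -- units 10⁻⁸/D²
      let Lmax := 2 * 10 ^ 4 * (D + cdivZ (2 * |P.tpN| * D) P.tpD)   -- ≥ every |partial|, units 10⁻⁴/D
      let U1 := P.distHiZ c.e1Lo c.e1Hi
      let U2 := P.distHiZ c.e2Lo c.e2Hi
      let dzx := x1.z - x0.z
      let dzy := y1.z - y0.z
      if 0 < J0 then
        -- B(Uk, dz) = logUp(⌈4 Uk Lmax U 10⁴ D/(J0 dz)⌉) + D   (over D)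
        let B := fun (Uk dz : ℤ) => logUpZ (cdivZ (4 * Uk * Lmax * P.U * 10 ^ 4 * D) (J0 * dz)) + D
        let pick (o : Option ℤ) (d : ℤ) : ℤ := match o with | some v => min v d | none => d
        let big : ℤ := 2 ^ 200
        -- (outer x, monotone e₁ in y) · (outer y, monotone e₁ in x) · (outer x, monotone e₂ in y) · (outer y, monotone e₂ in x)
        let r1 := P.tipVariant Y1.absLo (max |Y2.lo| |Y2.hi|) dzx (B U1 dzx)
        let r2 := P.tipVariant X1.absLo (max |X2.lo| |X2.hi|) dzy (B U1 dzy)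
        let r3 := P.tipVariant Y2.absLo (max |Y1.lo| |Y1.hi|) dzx (B U2 dzx)
        let r4 := P.tipVariant X2.absLo (max |X1.lo| |X1.hi|) dzy (B U2 dzy)
        let best := pick r4 (pick r3 (pick r2 (pick r1 big)))
        if best < big then some best else none
      else none
    else none
  | _, _, _, _ => none

/-! ## §3c The certificate tree and its fused kernel evaluation -/

/-- A certificate tree. Leaves: `o` (no hints), `d σx σy τx τy` (boundary hints for the straddling point: upper |sin| for the floor, lower |sin|
for the ceiling), `w τx σx τy σy τx' σx' τy' σy'` (tip hints). Internal: `n` (four children at the integer midpoints), `cx z l r` / `cy z l r`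
(an explicit cut `x = z/U` resp. `y = z/U`), `bx l r` / `bY l r` (midpoint cut in one coordinate). The KERNEL classifies every leaf cell from
the records; hints are checked, never trusted; disjointness is structural. [folklore] -/
inductive QB where
  | o : QB
  | d (σx σy τx τy : ℕ) : QB
  | w (τx σx τy σy τx' σx' τy' σy' : ℕ) : QB
  | n (c00 c10 c01 c11 : QB) : QB
  | cx (z : ℤ) (l r : QB) : QB
  | cy (z : ℤ) (l r : QB) : QB
  | bx (l r : QB) : QB
  | bY (l r : QB) : QB

/-- Add two optional ceilings (`none` is absorbing: one uncertified cell voids the ceiling). [folklore] -/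
def addO : Option ℤ → Option ℤ → Option ℤ
  | some a, some b => some (a + b)
  | _, _ => none

/-- FUSED LEAF EVALUATION: `(floor term, ceiling term)` of the cell `[x0, x1) × [y0, y1)` for a leaf with the given hints (absent hints are
COMPUTED by `sigmaAuto/tauAuto` — hints are a convenience, every use goes through a check).
Floor: round-10 terms, granted only inside `[−piLoZ, piLoZ)²`; ceiling: `0` on certified same-side cells, chord on two-shell squares (crude
otherwise), majorised hyperbola ∧ crude on single-straddle cells, tip rule (∧ crude) on tip cells. [folklore] -/
def Params.leaf (P : Params) (bd : Option (ℕ × ℕ × ℕ × ℕ)) (tp : Option (ℕ × ℕ × ℕ × ℕ × ℕ × ℕ × ℕ × ℕ)) (x0 x1 y0 y1 : Pt) :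
    ℤ × Option ℤ :=
  let c := P.cell x0 x1 y0 y1
  if !c.guards then (0, none) else
  let s1 := P.status c.e1Lo c.e1Hi
  let s2 := P.status c.e2Lo c.e2Hi
  let bz := P.inBZ x0 x1 y0 y1
  let crude := P.ceilCrude c x0 x1 y0 y1
  let minO (a : Option ℤ) (b : Option ℤ) : Option ℤ :=
    match a, b with | some u, some v => some (min u v) | some u, none => some u | none, some v => some v | none, none => none
  -- hints for a straddling `p` (unprimed ranges) resp. `p + q` (primed ranges): given, or computed (`sigmaAuto/tauAuto`)
  let hintsFor (sh : Bool) : ℕ × ℕ × ℕ × ℕ :=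
    match bd with
    | some h => h
    | none => if sh then (sigmaAuto c.aLo' c.aUp', sigmaAuto c.bLo' c.bUp', tauAuto c.aLo' c.aUp', tauAuto c.bLo' c.bUp')
              else (sigmaAuto c.aLo c.aUp, sigmaAuto c.bLo c.bUp, tauAuto c.aLo c.aUp, tauAuto c.bLo c.bUp)
  match s1, s2 with
  | some true, some true => (0, some 0)
  | some false, some false => (0, some 0)
  | some true, some false =>       -- two-shell, kind I
    ((if bz then P.floorInside true x0 x1 y0 y1 else 0), minO (P.ceilChord c true x0 x1 y0 y1) crude)
  | some false, some true =>       -- two-shell, kind II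
    ((if bz then P.floorInside false x0 x1 y0 y1 else 0), minO (P.ceilChord c false x0 x1 y0 y1) crude)
  | none, some far =>              -- p straddles; occ-on-crescent ⇔ far point EMPTY
    let occ := !far
    let (σx, σy, τx, τy) := hintsFor false
    ((if bz then P.floorBdry c false occ σx σy x0 x1 y0 y1 else 0), minO (P.ceilBdry c false occ τx τy x0 x1 y0 y1) crude)
  | some far, none =>              -- p + q straddles
    let occ := !far
    let (σx, σy, τx, τy) := hintsFor true
    ((if bz then P.floorBdry c true occ σx σy x0 x1 y0 y1 else 0), minO (P.ceilBdry c true occ τx τy x0 x1 y0 y1) crude)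
  | none, none =>                  -- tip
    let (τx, σx, τy, σy, τx', σx', τy', σy') : ℕ × ℕ × ℕ × ℕ × ℕ × ℕ × ℕ × ℕ :=
      match tp with
      | some h => h
      | none => (tauAuto c.aLo c.aUp, sigmaAuto c.aLo c.aUp, tauAuto c.bLo c.bUp, sigmaAuto c.bLo c.bUp,
                 tauAuto c.aLo' c.aUp', sigmaAuto c.aLo' c.aUp', tauAuto c.bLo' c.bUp', sigmaAuto c.bLo' c.bUp')
    (0, minO (P.ceilTip c τx σx τy σy τx' σx' τy' σy' x0 x1 y0 y1) crude)

/-- FUSED KERNEL EVALUATION of a certificate tree on the cell with corner records `x0, x1, y0, y1`: `(Σ floor terms, Σ ceiling terms or none)`.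
Internal nodes build the midpoint / cut records (the only place Taylor sums are evaluated); a cut outside `(x0, x1)` voids the ceiling. [folklore] -/
def QB.eval (P : Params) : QB → Pt → Pt → Pt → Pt → ℤ × Option ℤ
  | .o, x0, x1, y0, y1 => P.leaf none none x0 x1 y0 y1
  | .d σx σy τx τy, x0, x1, y0, y1 => P.leaf (some (σx, σy, τx, τy)) none x0 x1 y0 y1
  | .w a1 a2 a3 a4 a5 a6 a7 a8, x0, x1, y0, y1 => P.leaf none (some (a1, a2, a3, a4, a5, a6, a7, a8)) x0 x1 y0 y1
  | .n c00 c10 c01 c11, x0, x1, y0, y1 =>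
      let xm := P.mkX ((x0.z + x1.z) / 2)
      let ym := P.mkY ((y0.z + y1.z) / 2)
      let r00 := c00.eval P x0 xm y0 ym
      let r10 := c10.eval P xm x1 y0 ym
      let r01 := c01.eval P x0 xm ym y1
      let r11 := c11.eval P xm x1 ym y1
      (r00.1 + r10.1 + r01.1 + r11.1, addO (addO r00.2 r10.2) (addO r01.2 r11.2))
  | .cx z l r, x0, x1, y0, y1 =>
      if x0.z < z ∧ z < x1.z then
        let xm := P.mkX z
        let a := l.eval P x0 xm y0 y1
        let b := r.eval P xm x1 y0 y1
        (a.1 + b.1, addO a.2 b.2)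
      else (0, none)
  | .cy z l r, x0, x1, y0, y1 =>
      if y0.z < z ∧ z < y1.z then
        let ym := P.mkY z
        let a := l.eval P x0 x1 y0 ym
        let b := r.eval P x0 x1 ym y1
        (a.1 + b.1, addO a.2 b.2)
      else (0, none)
  | .bx l r, x0, x1, y0, y1 =>
      let xm := P.mkX ((x0.z + x1.z) / 2)
      let a := l.eval P x0 xm y0 y1
      let b := r.eval P xm x1 y0 y1
      (a.1 + b.1, addO a.2 b.2)
  | .bY l r, x0, x1, y0, y1 =>
      let ym := P.mkY ((y0.z + y1.z) / 2)
      let a := l.eval P x0 x1 y0 ym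
      let b := r.eval P x0 x1 ym y1
      (a.1 + b.1, addO a.2 b.2)

/-- Evaluation of a certificate on the ROOT square `[−Xz, Xz)²`. [folklore] -/
def Params.rootEval (P : Params) (t : QB) : ℤ × Option ℤ :=
  t.eval P (P.mkX (-P.Xz)) (P.mkX P.Xz) (P.mkY (-P.Xz)) (P.mkY P.Xz)

/-- Admissible parameters: positive denominators, `|t′| ≤ 9/20`, `t′μ < 1` (`b⋆` antitone), `0 < U`, the `π`-brackets
`piLoZ·10⁶ ≤ 3141592·U` and `3141593·U ≤ piUpZ·10⁶`, the root covers the zone (`piUpZ ≤ Xz`), and every abscissa stays within `2π`: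
`|q_i| + Xz ≤ 2·piLoZ` (range of validity of `mayMinZ/mayMaxZ/cosDirZ`). All integer comparisons. [folklore] -/
def Params.admissible (P : Params) : Bool :=
  decide (0 < P.tpD) && decide (0 < P.muD) && decide (20 * |P.tpN| ≤ 9 * P.tpD) && decide (P.tpN * P.muN < P.tpD * P.muD) &&
    decide (0 < P.U) && decide (P.piLoZ * 1000000 ≤ 3141592 * P.U) && decide (3141593 * P.U ≤ P.piUpZ * 1000000) &&
    decide (0 < P.piLoZ) && decide (P.piUpZ ≤ P.Xz) && decide (|P.q1z| + P.Xz ≤ 2 * P.piLoZ) && decide (|P.q2z| + P.Xz ≤ 2 * P.piLoZ)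

end Summit.HubbardSuperconductivity.HubbardSuperconductivity.Theorems.KlLindhardEnclosure

end
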